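import Mathlib.Analysis.Complex.CauchyIntegral
import Mathlib.MeasureTheory.Integral.IntegralEqImproper
import HarnessLib

/-!
# Shifting the line of integration inside a strip of analyticity

A general form of the contour shift `∫_ℝ g(x) dx = ∫_ℝ g(x + iY) dx` for a function `g` continuous on
the closed strip `0 ≤ Im z ≤ Y`, holomorphic on the open strip, and dominated there by an integrable
function of `Re z` that tends to `0` at `±∞` (Cauchy's theorem on the rectangles `[-T, T] × [0, Y]`,
the vertical sides being `≤ Y · b(±T) → 0`). The tree's
`PaleyWienerSchwartzBounded.integral_eq_integral_add_mul_I` is the special case of a Gaussian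
dominator and a function holomorphic on the whole upper half-plane; the strip version is what the
complex-translation estimates of Fröhlich–Spencer (FS81 Lemma 4.2/4.3, Condition (4.10) iii):
`|I_β(φ + ia)| ≤ e^{c(β)a²} I_β(φ)` on a strip) consume: translate `φ → φ + ia` in
`∫ e^{iqφ} F(φ) dφ` for `F` analytic on a strip only.

* `integral_eq_integral_add_mul_I_of_strip` (`Y ≥ 0`), `integral_eq_integral_sub_mul_I_of_strip`
  (the lower strip), and the translation bound `norm_integral_le_of_strip`:
  `‖∫ g(x) dx‖ ≤ ∫ ‖g(x + iY)‖ dx`.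

Everything is proved; no named fact is introduced.

## References

* J. Fröhlich, T. Spencer, Comm. Math. Phys. 81 (1981) 527–602, §4.2 Lemma 4.2, Condition (4.10),
  (4.12)–(4.16). [FrohlichSpencerKT1981]
-/

noncomputable section

open MeasureTheory Set Filter Complex
open scoped Topology

namespace Literature.Analysis.Complex

/-- **Contour shift in a strip.** Let `Y ≥ 0`, `g` continuous on `{0 ≤ Im z ≤ Y}`, holomorphic on
`{0 < Im z < Y}`, with `‖g z‖ ≤ b (Re z)` on the closed strip for an integrable `b` tending to `0` at
`±∞`. Then `∫ g(x) dx = ∫ g(x + iY) dx`. [folklore] -/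
theorem integral_eq_integral_add_mul_I_of_strip {g : ℂ → ℂ} {Y : ℝ} {b : ℝ → ℝ} (hY : 0 ≤ Y)
    (hgc : ContinuousOn g {z | 0 ≤ z.im ∧ z.im ≤ Y}) (hgd : DifferentiableOn ℂ g {z | 0 < z.im ∧ z.im < Y})
    (hgb : ∀ z : ℂ, 0 ≤ z.im → z.im ≤ Y → ‖g z‖ ≤ b z.re) (hb : Integrable b)
    (htop : Tendsto b atTop (𝓝 0)) (hbot : Tendsto b atBot (𝓝 0)) :
    ∫ x : ℝ, g x = ∫ x : ℝ, g (x + Y * I) := by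
  -- integrability on the two horizontal lines
  have hc0 : Continuous fun x : ℝ => g x :=
    hgc.comp_continuous continuous_ofReal fun x => by simp [hY]
  have hcY : Continuous fun x : ℝ => g (x + Y * I) :=
    hgc.comp_continuous (by fun_prop) fun x => by simp [hY]
  have hi0 : Integrable fun x : ℝ => g x :=
    hb.mono' hc0.aestronglyMeasurable (ae_of_all _ fun x => by
      simpa using hgb x (by simp) (by simp [hY]))
  have hiY : Integrable fun x : ℝ => g (x + Y * I) :=
    hb.mono' hcY.aestronglyMeasurable (ae_of_all _ fun x => by
      simpa using hgb (x + Y * I) (by simp [hY]) (by simp))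
  -- Cauchy on the rectangle `[-T, T] × [0, Y]`
  have hrect : ∀ T : ℝ, (∫ x in -T..T, g x) - (∫ x in -T..T, g (x + Y * I)) +
      I • (∫ y in (0 : ℝ)..Y, g (T + y * I)) - I • (∫ y in (0 : ℝ)..Y, g (-T + y * I)) = 0 := by
    intro T
    have h := Complex.integral_boundary_rect_eq_zero_of_continuousOn_of_differentiableOn g
      ((-T : ℝ) : ℂ) (T + Y * I) ?_ ?_
    · simpa using h
    · refine hgc.mono fun z hz => ?_
      have : z.im ∈ Set.uIcc (0 : ℝ) Y := by simpa using hz.2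
      rw [Set.uIcc_of_le hY] at this
      exact ⟨this.1, this.2⟩
    · refine hgd.mono fun z hz => ?_
      have : z.im ∈ Ioo (min (0 : ℝ) Y) (max 0 Y) := by simpa using hz.2
      rw [min_eq_left hY, max_eq_right hY] at this
      exact ⟨this.1, this.2⟩
  -- limits of the four sides
  have hH0 : Tendsto (fun T : ℝ => ∫ x in -T..T, g x) atTop (𝓝 (∫ x : ℝ, g x)) :=
    intervalIntegral_tendsto_integral hi0 tendsto_neg_atTop_atBot tendsto_id
  have hHY : Tendsto (fun T : ℝ => ∫ x in -T..T, g (x + Y * I)) atTop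
      (𝓝 (∫ x : ℝ, g (x + Y * I))) :=
    intervalIntegral_tendsto_integral hiY tendsto_neg_atTop_atBot tendsto_id
  have hV1 : Tendsto (fun T : ℝ => ∫ y in (0 : ℝ)..Y, g (T + y * I)) atTop (𝓝 0) := by
    have hlim : Tendsto (fun T : ℝ => b T * |Y - 0|) atTop (𝓝 0) := by
      simpa using htop.mul_const |Y - 0|
    refine squeeze_zero_norm (fun T => ?_) hlim
    refine intervalIntegral.norm_integral_le_of_norm_le_const fun y hy => ?_
    rw [Set.uIoc_of_le hY] at hy
    have := hgb (T + y * I) (by simpa using hy.1.le) (by simpa using hy.2)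
    simpa using this
  have hV2 : Tendsto (fun T : ℝ => ∫ y in (0 : ℝ)..Y, g (-T + y * I)) atTop (𝓝 0) := by
    have hlim : Tendsto (fun T : ℝ => b (-T) * |Y - 0|) atTop (𝓝 0) := by
      simpa using (hbot.comp tendsto_neg_atTop_atBot).mul_const |Y - 0|
    refine squeeze_zero_norm (fun T => ?_) hlim
    refine intervalIntegral.norm_integral_le_of_norm_le_const fun y hy => ?_
    rw [Set.uIoc_of_le hY] at hy
    have := hgb (-T + y * I) (by simpa using hy.1.le) (by simpa using hy.2)
    simpa using this
  have hlim : Tendsto (fun T : ℝ => (∫ x in -T..T, g x) - (∫ x in -T..T, g (x + Y * I)) +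
      I • (∫ y in (0 : ℝ)..Y, g (T + y * I)) - I • (∫ y in (0 : ℝ)..Y, g (-T + y * I))) atTop
      (𝓝 ((∫ x : ℝ, g x) - (∫ x : ℝ, g (x + Y * I)) + I • 0 - I • 0)) :=
    ((hH0.sub hHY).add (hV1.const_smul I)).sub (hV2.const_smul I)
  simp only [hrect, smul_zero, add_zero, sub_zero, tendsto_const_nhds_iff] at hlim
  exact sub_eq_zero.1 hlim.symm

/-- **Contour shift into the lower strip**: under the mirrored hypotheses on `{-Y ≤ Im z ≤ 0}`,
`∫ g(x) dx = ∫ g(x - iY) dx`. [folklore] -/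
theorem integral_eq_integral_sub_mul_I_of_strip {g : ℂ → ℂ} {Y : ℝ} {b : ℝ → ℝ} (hY : 0 ≤ Y)
    (hgc : ContinuousOn g {z | -Y ≤ z.im ∧ z.im ≤ 0}) (hgd : DifferentiableOn ℂ g {z | -Y < z.im ∧ z.im < 0})
    (hgb : ∀ z : ℂ, -Y ≤ z.im → z.im ≤ 0 → ‖g z‖ ≤ b z.re) (hb : Integrable b)
    (htop : Tendsto b atTop (𝓝 0)) (hbot : Tendsto b atBot (𝓝 0)) :
    ∫ x : ℝ, g x = ∫ x : ℝ, g (x - Y * I) := by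
  -- apply the upper-strip version to `h z = g (z - iY)`
  set h : ℂ → ℂ := fun z => g (z - Y * I) with hh
  have hsub : ∀ z : ℂ, (z - Y * I).im = z.im - Y := fun z => by simp
  have hre : ∀ z : ℂ, (z - Y * I).re = z.re := fun z => by simp
  have hmap : Continuous fun z : ℂ => z - Y * I := by fun_prop
  have hhc : ContinuousOn h {z | 0 ≤ z.im ∧ z.im ≤ Y} := by
    refine hgc.comp hmap.continuousOn fun z hz => ?_
    simp only [Set.mem_setOf_eq, hsub] at hz ⊢
    constructor <;> linarith [hz.1, hz.2]
  have hhd : DifferentiableOn ℂ h {z | 0 < z.im ∧ z.im < Y} := by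
    refine hgd.comp (by fun_prop : Differentiable ℂ fun z : ℂ => z - Y * I).differentiableOn fun z hz => ?_
    simp only [Set.mem_setOf_eq, hsub] at hz ⊢
    constructor <;> linarith [hz.1, hz.2]
  have hhb : ∀ z : ℂ, 0 ≤ z.im → z.im ≤ Y → ‖h z‖ ≤ b z.re := fun z h1 h2 => by
    have := hgb (z - Y * I) (by rw [hsub]; linarith) (by rw [hsub]; linarith)
    rwa [hre] at this
  have key := integral_eq_integral_add_mul_I_of_strip hY hhc hhd hhb hb htop hbot
  -- `h (x + iY) = g x`, `h x = g (x - iY)`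
  have e1 : (fun x : ℝ => h (x + Y * I)) = fun x : ℝ => g x := by
    funext x; simp only [hh]; congr 1; ring
  have e2 : (fun x : ℝ => h x) = fun x : ℝ => g (x - Y * I) := rfl
  rw [e1, e2] at key
  exact key.symm

/-- **The translation bound**: under the hypotheses of the strip contour shift,
`‖∫ g(x) dx‖ ≤ ∫ ‖g(x + iY)‖ dx`. [cite: FrohlichSpencerKT1981, §4.2 (4.12)–(4.16)] -/
theorem norm_integral_le_of_strip {g : ℂ → ℂ} {Y : ℝ} {b : ℝ → ℝ} (hY : 0 ≤ Y)
    (hgc : ContinuousOn g {z | 0 ≤ z.im ∧ z.im ≤ Y}) (hgd : DifferentiableOn ℂ g {z | 0 < z.im ∧ z.im < Y})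
    (hgb : ∀ z : ℂ, 0 ≤ z.im → z.im ≤ Y → ‖g z‖ ≤ b z.re) (hb : Integrable b)
    (htop : Tendsto b atTop (𝓝 0)) (hbot : Tendsto b atBot (𝓝 0)) :
    ‖∫ x : ℝ, g x‖ ≤ ∫ x : ℝ, ‖g (x + Y * I)‖ := by
  rw [integral_eq_integral_add_mul_I_of_strip hY hgc hgd hgb hb htop hbot]
  exact norm_integral_le_integral_norm _

end Literature.Analysis.Complex
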